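import Literature.MathematicalPhysics.StatisticalMechanics.PeriodicConfigurationSums
import Literature.Geometry.DiscreteGeometry.KissingPatterns
import HarnessLib

/-!
# `PeriodicStarCoercivity` (route `ReggeStarCoercivity`, item stmt-AtomisticToContinuum-13602) — shared definitions
of the line `pinned-equilibria-reduction`

Crux (route file, fixed): `∃ g > 0, ∀ P : PeriodicConfiguration 3, ePer + g·#def(P)/#motif(P) ≤ e_LJ(P)`
(Blanc–Lewin units `V = r⁻¹²/12 − r⁻⁶/6`), a motif site `s` being DEFECTIVE unless its recentred shell (other
points of `P.points` within absolute radius `6/5`), rescaled by `a⁻¹` for some `a ∈ [9/10, 11/10]`, is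
`1/20`-`ShellCloseTo` the fcc or the hcp kissing pattern.

This file only DEFINES the objects in which the line's registered stubs are stated (D-0016: objects a
route posits live in a reviewed `…Defs` file, never inside a proof file), so that the stub files
`ReggeStarCoercivityPeriodicStarCoercivity<Stub>.lean` and the lead's skeleton share ONE vocabulary:

* §1 verbatim sub-terms of the crux: `shell`, `Near η` (`η`-closeness of the rescaled shell to a Barlow
  pattern at an admissible scale), `IsFree = Near (1/20)`, `e`, `ePer`, the charge sets `defectSet ⊇
  nearDefSet ∪ farDefSet` (split at the near/far seam `η = 7/100`) and the fractions `defectFrac`, `ndFrac`,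
  `fdFrac`, and `PSCAt g P` (the body of the crux, left-associated as in the route decl, so that the crux is
  `∃ g > 0, ∀ P, PSCAt g P` by `Iff.rfl`);
* §2 the pinned-equilibrium vocabulary, in VARIATIONAL (derivative-free) form: `IsMove` (one sublattice moved,
  same lattice, no orbit merged), `SameStatus`, `Robust ρ` (moving the sublattice of `s` by `< ρ` flips no
  status), `IsLinImage` (image under a linear map: motif `A(F)`, lattice `A(G)`), `MetricRobust ρ`, and
  `Equilibrated ε ρ P`: no status-preserving sublattice move of size `< ρ` at a `ρ`-robust site lowers the energy
  per CELL by more than `ε ρ`, and — when the whole classification is `ρ`-metric-robust — no linear image with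
  `‖A − 1‖ < ρ` lowers the energy per particle by more than `ε ρ`.  For a configuration whose energy is `C²`
  along such moves this gives `‖sublattice force‖ ≤ ε + L ρ` and `|stress| ≤ ε + L′ρ` (Taylor), i.e. the
  force-balance / zero-stress rows of the idea card up to constants the consumer controls; the variational form
  is what makes the frozen-status DESCENT (stub `stub_frozenDescent`) a finite combinatorial argument on top of
  the landed energy floor (item 0714) with no lattice-sum calculus;
* §3 collar vocabulary: `IsFarDef` (far-defective POINT of `P.points`), `Isolated R`, `isolatedNearDefSet R`,
  `collarSet R`.

Design notes. (i) `IsMove` forbids `t` to be ANOTHER motif point (an orbit merge would change `#motif` and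
hence the fractions while preserving every status); `t = s` (no move) and `t ∉ P.motif` are allowed; a `t`
equivalent modulo the lattice to another motif point admits no `P'` at all (`eq_of_sub_mem`). (ii) All radii
and tolerances are the numerals of the route decl (`6/5`, `9/10`, `11/10`, `1/20`) and of the line (`7/100`).
(iii) Nothing here is a statement except the anchor lemma `stub_defsPartition` (`#def = #nearDef + #farDef`,
registered as a sub-goal so that a definitions file can be proposed `--supports` the crux); the regime statements
and the stubs live in the skeleton `Cruxes/PeriodicStarCoercivity/Lines/pinned_equilibria_reduction.lean` and in
the stub files.
-/

noncomputable section

open scoped BigOperators Classical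
open Literature.MathematicalPhysics.StatisticalMechanics Literature.Geometry.DiscreteGeometry

namespace Summit.AtomisticToContinuum.Crystallization.Theorems.ReggeStarCoercivityPeriodicStarCoercivity

/-! ## §1 Verbatim sub-terms of the crux -/

/-- The recentred first shell of `s` in `P` (other points of `P.points` within ABSOLUTE radius `6/5`),
rescaled by `a⁻¹` — literally the sub-term of the route decl `ReggeStarCoercivity.PeriodicStarCoercivity`. -/
def shell (P : PeriodicConfiguration 3) (s : (EuclideanSpace ℝ (Fin 3))) (a : ℝ) : Finset (EuclideanSpace ℝ (Fin 3)) :=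
  (P.finite_inter_points (K := Metric.closedBall s (6 / 5) \ {s})
      (Metric.isBounded_closedBall.subset Set.sdiff_subset)).toFinset.image fun y => a⁻¹ • (y - s)

/-- `s` is `η`-NEAR a Barlow shell in `P`: for some admissible scale `a ∈ [9/10, 11/10]` the rescaled shell
is `η`-`ShellCloseTo` the fcc or the hcp kissing pattern (crux: `η = 1/20`; near/far seam of the line:
`η = 7/100`). -/
def Near (η : ℝ) (P : PeriodicConfiguration 3) (s : (EuclideanSpace ℝ (Fin 3))) : Prop :=
  ∃ a : ℝ, 9 / 10 ≤ a ∧ a ≤ 11 / 10 ∧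
    (ShellCloseTo η (shell P s a) fccKissingPattern ∨ ShellCloseTo η (shell P s a) hcpKissingPattern)

/-- FREE (non-defective) site of the crux: `1/20`-near. -/
def IsFree (P : PeriodicConfiguration 3) (s : (EuclideanSpace ℝ (Fin 3))) : Prop := Near (1 / 20) P s

/-- Lennard-Jones energy per particle of a periodic configuration. -/
def e (P : PeriodicConfiguration 3) : ℝ := P.energyPerParticle lennardJones

/-- `ePer = ⨅_Q e(Q)` over all periodic configurations of `ℝ³` (a genuine infimum by item 0714). -/
def ePer : ℝ := ⨅ Q : PeriodicConfiguration 3, Q.energyPerParticle lennardJones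

/-- Defective motif sites (the crux's charge set). -/
def defectSet (P : PeriodicConfiguration 3) : Finset (EuclideanSpace ℝ (Fin 3)) := P.motif.filter fun s => ¬ IsFree P s

/-- NEAR-DEFECTIVE motif sites: defective but `7/100`-near. -/
def nearDefSet (P : PeriodicConfiguration 3) : Finset (EuclideanSpace ℝ (Fin 3)) := (defectSet P).filter fun s => Near (7 / 100) P s

/-- FAR-DEFECTIVE motif sites ("junk"): defective and not `7/100`-near. -/
def farDefSet (P : PeriodicConfiguration 3) : Finset (EuclideanSpace ℝ (Fin 3)) := (defectSet P).filter fun s => ¬ Near (7 / 100) P s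

/-- The crux's defect fraction `#def / #motif`. -/
def defectFrac (P : PeriodicConfiguration 3) : ℝ := ((defectSet P).card : ℝ) / (P.motif.card : ℝ)

/-- The near-defective fraction `#nearDef / #motif`. -/
def ndFrac (P : PeriodicConfiguration 3) : ℝ := ((nearDefSet P).card : ℝ) / (P.motif.card : ℝ)

/-- The far-defective fraction `#farDef / #motif`. -/
def fdFrac (P : PeriodicConfiguration 3) : ℝ := ((farDefSet P).card : ℝ) / (P.motif.card : ℝ)

/-- The body of the crux at `g` and `P`, in the route decl's own left-associated form `g * #def / #motif`. -/
def PSCAt (g : ℝ) (P : PeriodicConfiguration 3) : Prop :=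
  ePer + g * ((defectSet P).card : ℝ) / (P.motif.card : ℝ) ≤ e P

/-! ## §2 Pinned equilibria (variational form) -/

/-- `P'` is `P` with the sublattice through `s` moved so as to pass through `t`: same lattice, motif
`insert t (P.motif.erase s)`, and `t` is not another motif point (no orbit is merged). -/
def IsMove (P : PeriodicConfiguration 3) (s t : (EuclideanSpace ℝ (Fin 3))) (P' : PeriodicConfiguration 3) : Prop :=
  P'.lattice = P.lattice ∧ t ∉ P.motif.erase s ∧ P'.motif = insert t (P.motif.erase s)

/-- The two statuses the charge reads (`1/20`-free, `7/100`-near) agree at `s` in `P` and at `t` in `P'`. -/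
def SameStatus (P : PeriodicConfiguration 3) (s : (EuclideanSpace ℝ (Fin 3))) (P' : PeriodicConfiguration 3) (t : (EuclideanSpace ℝ (Fin 3))) : Prop :=
  (IsFree P s ↔ IsFree P' t) ∧ (Near (7 / 100) P s ↔ Near (7 / 100) P' t)

/-- `s` is `ρ`-ROBUSTLY classified in `P`: moving the sublattice of `s` to pass through any `t` with
`dist t s < ρ` changes the status of no motif site. Antitone in `ρ`. -/
def Robust (ρ : ℝ) (P : PeriodicConfiguration 3) (s : (EuclideanSpace ℝ (Fin 3))) : Prop :=
  ∀ (t : (EuclideanSpace ℝ (Fin 3))) (P' : PeriodicConfiguration 3), dist t s < ρ → IsMove P s t P' →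
    SameStatus P s P' t ∧ ∀ s' ∈ P.motif, s' ≠ s → SameStatus P s' P' s'

/-- `P''` is the image of `P` under the linear map `A`: motif `A(F)` (as a `Finset.image`) and lattice of
periods `A(G)` (as sets). For `‖A − 1‖ < 1`, or whenever such a `P''` exists at all, `A` is invertible. -/
def IsLinImage (P : PeriodicConfiguration 3) (A : (EuclideanSpace ℝ (Fin 3)) →L[ℝ] (EuclideanSpace ℝ (Fin 3))) (P'' : PeriodicConfiguration 3) : Prop :=
  P''.motif = P.motif.image A ∧ (P''.lattice : Set (EuclideanSpace ℝ (Fin 3))) = A '' (P.lattice : Set (EuclideanSpace ℝ (Fin 3)))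

/-- The whole classification of `P` is `ρ`-robust under LINEAR moves: every linear image of `P` by an `A`
with `‖A − 1‖ < ρ` has, site by site (`s ↦ A s`), the same statuses. Antitone in `ρ`. -/
def MetricRobust (ρ : ℝ) (P : PeriodicConfiguration 3) : Prop :=
  ∀ (A : (EuclideanSpace ℝ (Fin 3)) →L[ℝ] (EuclideanSpace ℝ (Fin 3))) (P'' : PeriodicConfiguration 3), ‖A - 1‖ < ρ → IsLinImage P A P'' →
    ∀ s ∈ P.motif, SameStatus P s P'' (A s)

/-- **`(ε, ρ)`-PINNED EQUILIBRIUM (variational form).** (a) At every `ρ`-robust motif site `s`, no move of the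
sublattice of `s` to a point `t` with `dist t s < ρ` lowers the energy per CELL `#motif · e` by more than
`ε ρ`; (b) if the whole classification is `ρ`-metric-robust, no linear image by an `A` with `‖A − 1‖ < ρ`
lowers the energy per particle by more than `ε ρ`. For energies twice differentiable along such moves this
is force balance `‖F_s‖ ≤ ε + L ρ` at robust sites and zero stress `≤ ε + L′ ρ`, by Taylor. Monotone in `ε`. -/
def Equilibrated (ε ρ : ℝ) (P : PeriodicConfiguration 3) : Prop :=
  (∀ s ∈ P.motif, Robust ρ P s → ∀ (t : (EuclideanSpace ℝ (Fin 3))) (P' : PeriodicConfiguration 3), dist t s < ρ → IsMove P s t P' →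
      (P.motif.card : ℝ) * (e P - e P') ≤ ε * ρ) ∧
  (MetricRobust ρ P → ∀ (A : (EuclideanSpace ℝ (Fin 3)) →L[ℝ] (EuclideanSpace ℝ (Fin 3))) (P'' : PeriodicConfiguration 3), ‖A - 1‖ < ρ → IsLinImage P A P'' →
      e P - e P'' ≤ ε * ρ)

/-! ## §3 Collar vocabulary -/

/-- A far-defective POINT of `P` (any point of `P.points`, not only a motif representative). -/
def IsFarDef (P : PeriodicConfiguration 3) (y : (EuclideanSpace ℝ (Fin 3))) : Prop := ¬ IsFree P y ∧ ¬ Near (7 / 100) P y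

/-- `s` is `R`-ISOLATED from the junk of `P`: every far-defective point of `P.points` is at distance `≥ R`. -/
def Isolated (R : ℝ) (P : PeriodicConfiguration 3) (s : (EuclideanSpace ℝ (Fin 3))) : Prop := ∀ y ∈ P.points, IsFarDef P y → R ≤ dist s y

/-- Near-defective motif sites that are `R`-isolated from the junk. -/
def isolatedNearDefSet (R : ℝ) (P : PeriodicConfiguration 3) : Finset (EuclideanSpace ℝ (Fin 3)) := (nearDefSet P).filter fun s => Isolated R P s

/-- The `R`-COLLAR: `7/100`-near motif sites (free or near-defective) within `R` of some far-defective point. -/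
def collarSet (R : ℝ) (P : PeriodicConfiguration 3) : Finset (EuclideanSpace ℝ (Fin 3)) :=
  P.motif.filter fun s => Near (7 / 100) P s ∧ ¬ Isolated R P s


/-! ## §4 Anchor lemma (registered sub-goal `stub_defsPartition`, so that this definitions file can ride
`--supports` on the crux item) -/

/-- `#def = #nearDef + #farDef`: the defect set is partitioned by the `7/100` status. -/
theorem stub_defsPartition :
    ∀ P : PeriodicConfiguration 3, (defectSet P).card = (nearDefSet P).card + (farDefSet P).card := by
  intro P
  unfold nearDefSet farDefSet
  rw [Finset.card_filter_add_card_filter_not]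

end Summit.AtomisticToContinuum.Crystallization.Theorems.ReggeStarCoercivityPeriodicStarCoercivity

end
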